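import Summits.ResolutionOfSingularities.ResolutionOfSingularities.Theorems.PurelyInseparableDim4E2OfCJSSetting
import HarnessLib

/-!
# The p-PROGRAM of the E2 dictionary, row (X) and the stalk plumbing for EVERY prime `p`
# («for every prime p ≥ 3: no isolated cone-two chain over K̄ ⟸ CJS Thm 6.40», cell `res-dim4-pi`, WORD #66)

[OURS · counted 0 · AI work weaker than expert review.]  Cell `res-dim4-pi` (D-0157 DOOR 2), seat `res-dim4-p-2`
g2 (holder).  NOTHING here proves CJS Thm. 6.40, K2(p), `NoWideTrap p p`, or resolution of singularities in
dimension ≥ 4 / characteristic `p`.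

The p = 3 file `…E2OfCJSSetting` (p664844) with `3 ↦ p` throughout — the content was never 3-specific: the
germ `g₀` of `z^p + F` at the origin of `𝔸⁵_L`, `(z^p + F)_0 = (g₀)`, `g₀ ∈ 𝔪` non-zero, the hypersurface local
ring `𝒪_{𝔸⁵,0} ⧸ (g₀)` of dimension `4`, excellent, of characteristic `p`; (F1) in dimension `4` for every
residue characteristic `≥ 3` (`4 + 2 ≤ 2·p`); and ROW (X) in UNFOLDED form for every prime `p ≥ 3`
(`settingRow_unfolded`: excellent, `dim ≤ 5`, (F1), point centre permissible) — the two-line adapter to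
res-dim4-p-3 g2's `SettingRowP p` follows his `…E2OfCJSRowsPrime`.

bears_on: LADDER-RESOLUTION:D157-DOOR2 (res-dim4-pi · F4-I(p,p) · CJS dictionary · row X_p).  Supports
stmt-ResolutionOfSingularities-16155 (helper).
-/

set_option linter.dupNamespace false -- mandated namespace of this single-conjunct summit

noncomputable section

universe u

open CategoryTheory AlgebraicGeometry TopologicalSpace IsLocalRing
open Literature.AlgebraicGeometry.Resolution
open Literature.AlgebraicGeometry.Resolution.Hauser2010
open Literature.AlgebraicGeometry.Resolution.AffinePointBlowup (P A γ ξ)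
open Literature.AlgebraicGeometry.Hironaka2017.SpecOrders
open Literature.AlgebraicGeometry.CossartJannsenSaito2020
open Scheme.IdealSheafData

namespace Summit.ResolutionOfSingularities.ResolutionOfSingularities.Theorems.PIDim4

namespace E2OfCJS

open SigmaMaxModificationsCorridor3.Moving.LocalChains (topologicalKrullDim_eq_of_isLocalAt isExcellent_of_isLocalAt)

/-! ## §0 (F1) in dimension `4` for every residue characteristic `≥ 3` -/

/-- **(F1) HOLDS for a 4-dimensional scheme at a point of residue characteristic `≥ 3`**: `4 + 2 ≤ 2·char`
(«`char k(x) ≥ dim X/2 + 1`»). [cite: CossartJannsenSaito2020, Thm. 10.2] -/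
theorem charHypothesis_of_dim_four_of_three_le_char {X : Scheme.{u}} (x : X)
    (hd : topologicalKrullDim ↥X = (4 : WithBot ℕ∞))
    (hc : 3 ≤ ringChar (ResidueField (X.presheaf.stalk x))) : CharHypothesis X x :=
  ⟨4, by exact_mod_cast hd, Or.inr (by omega)⟩

namespace Prime

variable (L : Type) [Field L] (p : ℕ)

/-! ## §1 The germ of `z^p + F` at the origin -/

/-- `(z^p + F)(0) = F(0)` for `p ≠ 0`. [folklore] -/
theorem constantCoeff_hyp (hp : p ≠ 0) (F : MvPolynomial (Fin 4) L) :
    MvPolynomial.constantCoeff (hyp p F) = MvPolynomial.constantCoeff F := by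
  unfold hyp
  rw [map_add, map_pow, MvPolynomial.constantCoeff_X, zero_pow hp, zero_add, MvPolynomial.constantCoeff_rename]

/-- `z^p + F ≠ 0`: the monomial `z^p` survives (`F` does not involve `z`), `p ≠ 0`. [folklore] -/
theorem hyp_ne_zero (hp : p ≠ 0) (F : MvPolynomial (Fin 4) L) : hyp p F ≠ 0 := by
  intro h
  have hc := congrArg (MvPolynomial.coeff (Finsupp.single 0 p)) h
  have h0 : MvPolynomial.coeff (Finsupp.single (0 : Fin (4 + 1)) p) (MvPolynomial.rename Fin.succ F) = 0 := by
    apply MvPolynomial.coeff_rename_eq_zero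
    intro u hu
    exfalso
    have := DFunLike.congr_fun hu 0
    rw [Finsupp.mapDomain_notin_range, Finsupp.single_eq_same] at this
    · exact hp this.symm
    · rintro ⟨i, hi⟩; exact Fin.succ_ne_zero i hi
  unfold hyp at hc
  rw [MvPolynomial.coeff_add, MvPolynomial.coeff_X_pow, if_pos rfl, h0, add_zero, MvPolynomial.coeff_zero] at hc
  exact one_ne_zero hc

/-- **The germ `g₀` of `z^p + F` in `𝒪_{𝔸⁵_L,0}`.** [folklore] -/
abbrev hypGerm (F : MvPolynomial (Fin 4) L) : originStalk L := algebraMap (A 4 L) (originStalk L) (hyp p F)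

/-- **`(z^p + F)_0 = (g₀)`**: the stalk of `hypSheaf p F` at the origin is principal, generated by the germ.
[folklore] -/
theorem stalkIdeal_hypSheaf_ξ (F : MvPolynomial (Fin 4) L) :
    stalkIdeal (hypSheaf p F) (ξ 4 L) = Ideal.span {hypGerm L p F} := by
  have h : hypSheaf p F = shf (A 4 L) (Ideal.span {hyp p F}) := by
    unfold hypSheaf shf; rw [Ideal.map_span, Set.image_singleton]; rfl
  rw [h, stalkIdeal_shf, Ideal.map_span, Set.image_singleton]

/-- `g₀ ∈ 𝔪_{𝔸⁵,0}` when `F(0) = 0` (`p ≠ 0`). [folklore] -/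
theorem hypGerm_mem_maximalIdeal (hp : p ≠ 0) (F : MvPolynomial (Fin 4) L)
    (hF : MvPolynomial.constantCoeff F = 0) : hypGerm L p F ∈ maximalIdeal (originStalk L) := by
  have h1 : hyp p F ∈ (ξ 4 L).asIdeal := by
    show hyp p F ∈ Literature.AlgebraicGeometry.Resolution.originIdeal L 5
    rw [Literature.AlgebraicGeometry.Resolution.mem_originIdeal_iff, constantCoeff_hyp L p hp]; exact hF
  exact (IsLocalization.AtPrime.to_map_mem_maximal_iff (originStalk L) (ξ 4 L).asIdeal (hyp p F)).mpr h1

/-- `g₀ ≠ 0`. [folklore] -/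
theorem hypGerm_ne_zero (hp : p ≠ 0) (F : MvPolynomial (Fin 4) L) : hypGerm L p F ≠ 0 := by
  intro h
  have hinj := IsLocalization.injective (originStalk L) (Ideal.primeCompl_le_nonZeroDivisors (ξ 4 L).asIdeal)
  exact hyp_ne_zero L p hp F (hinj (by rw [map_zero]; exact h))

/-- `g₀` is a non-zero-divisor. [folklore] -/
theorem hypGerm_mem_nonZeroDivisors (hp : p ≠ 0) (F : MvPolynomial (Fin 4) L) :
    hypGerm L p F ∈ nonZeroDivisors (originStalk L) := by
  haveI := isDomain_originStalk L
  exact mem_nonZeroDivisors_of_ne_zero (hypGerm_ne_zero L p hp F)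

/-! ## §2 The hypersurface local ring `𝒪_{𝔸⁵,0} ⧸ (g₀)`: dimension `4`, excellent, characteristic `p` -/

/-- **`dim 𝒪_{𝔸⁵_L,0} ⧸ (z^p + F) = 4`** when `F(0) = 0`, `p ≠ 0`. [folklore] -/
theorem ringKrullDim_originStalk_quot (hp : p ≠ 0) (F : MvPolynomial (Fin 4) L)
    (hF : MvPolynomial.constantCoeff F = 0) : ringKrullDim (originStalk L ⧸ Ideal.span {hypGerm L p F}) = 4 := by
  have h := ringKrullDim_quotient_span_singleton_succ_eq_ringKrullDim_of_mem_nonZeroDivisors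
    (hypGerm_mem_nonZeroDivisors L p hp F) (hypGerm_mem_maximalIdeal L p hp F hF)
  rw [ringKrullDim_originStalk] at h
  generalize hd : ringKrullDim (originStalk L ⧸ Ideal.span {hypGerm L p F}) = d at h
  cases d with
  | bot => exact absurd h (by decide)
  | coe a =>
    cases a with
    | top => exact absurd h (by decide)
    | coe n =>
      have h1 : (((n + 1 : ℕ) : ℕ∞) : WithBot ℕ∞) = (((5 : ℕ) : ℕ∞) : WithBot ℕ∞) := by
        push_cast; exact h
      have h2 : ((n + 1 : ℕ) : ℕ∞) = ((5 : ℕ) : ℕ∞) := WithBot.coe_injective h1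
      have h3 : n + 1 = 5 := by exact_mod_cast h2
      have hn : n = 4 := by omega
      subst hn; rfl

/-- **`𝒪_{𝔸⁵_L,0} ⧸ (z^p + F)` is EXCELLENT.** [cite: Matsumura1987, §32 p. 260] -/
theorem isExcellentRing_originStalk_quot (F : MvPolynomial (Fin 4) L) :
    IsExcellentRing (originStalk L ⧸ Ideal.span {hypGerm L p F}) := by
  have hA : IsExcellentRing (A 4 L) := (isExcellentRing_of_field L).of_finiteType'
  have hR : IsExcellentRing (originStalk L) := IsExcellentRing.of_isLocalization (ξ 4 L).asIdeal.primeCompl hA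
  exact IsExcellentRing.of_surjective (Ideal.Quotient.mk _) Ideal.Quotient.mk_surjective hR

/-- The quotient is non-trivial when `F(0) = 0`, `p ≠ 0`. [folklore] -/
theorem nontrivial_originStalk_quot (hp : p ≠ 0) (F : MvPolynomial (Fin 4) L)
    (hF : MvPolynomial.constantCoeff F = 0) : Nontrivial (originStalk L ⧸ Ideal.span {hypGerm L p F}) :=
  Ideal.Quotient.nontrivial_iff.mpr fun h =>
    (IsLocalRing.mem_maximalIdeal _ |>.mp (hypGerm_mem_maximalIdeal L p hp F hF)) (Ideal.span_singleton_eq_top.mp h)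

/-- **`𝒪_{𝔸⁵_L,0} ⧸ (z^p + F)` has characteristic `p`** when `L` has. [folklore] -/
theorem charP_originStalk_quot [hpr : Fact p.Prime] [CharP L p] (F : MvPolynomial (Fin 4) L)
    (hF : MvPolynomial.constantCoeff F = 0) : CharP (originStalk L ⧸ Ideal.span {hypGerm L p F}) p := by
  haveI := nontrivial_originStalk_quot L p hpr.out.ne_zero F hF
  exact charP_of_injective_ringHom
    (((Ideal.Quotient.mk (Ideal.span {hypGerm L p F})).comp
      ((algebraMap (A 4 L) (originStalk L)).comp (MvPolynomial.C : L →+* A 4 L))).injective) p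

/-! ## §3 Presented local rings and row (X) for every prime `p ≥ 3` (unfolded form) -/

/-- **`𝒪_{𝔸⁵,0} ⧸ (z^p + F)_0 ≅ 𝒪_{𝔸⁵,0} ⧸ (g₀)`** as rings. [folklore] -/
def hypStalkEquivQuot (F : MvPolynomial (Fin 4) L) :
    ((P 4 L).presheaf.stalk (ξ 4 L) ⧸ stalkIdeal (hypSheaf p F) (ξ 4 L)) ≃+*
      originStalk L ⧸ Ideal.span {hypGerm L p F} :=
  Ideal.quotEquivOfEq (stalkIdeal_hypSheaf_ξ L p F)

variable {L p}

/-- Residual order `p ≠ 0` makes `F` vanish at the origin. [folklore] -/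
theorem constantCoeff_eq_zero_of_ordZero_eq (hp : p ≠ 0) {F : MvPolynomial (Fin 4) L}
    (hF : ordZero F = (p : ℕ∞)) : MvPolynomial.constantCoeff F = 0 := by
  rw [← one_le_ordZero_iff, hF]
  exact_mod_cast Nat.one_le_iff_ne_zero.mpr hp

/-- **The local ring of a point presented by `z^p + F` has dimension `4`, is excellent, and has
characteristic `p`.** [folklore] -/
theorem presented_stalk_facts [hpr : Fact p.Prime] [CharP L p] {F : MvPolynomial (Fin 4) L}
    (hF : ordZero F = (p : ℕ∞)) {S : Scheme.{0}} {s : S}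
    (h : Nonempty (S.presheaf.stalk s ≅
      CommRingCat.of ((P 4 L).presheaf.stalk (ξ 4 L) ⧸ stalkIdeal (hypSheaf p F) (ξ 4 L)))) :
    ringKrullDim (S.presheaf.stalk s) = 4 ∧ IsExcellentRing (S.presheaf.stalk s) ∧
      CharP (S.presheaf.stalk s) p := by
  have hp : p ≠ 0 := hpr.out.ne_zero
  have hF0 := constantCoeff_eq_zero_of_ordZero_eq hp hF
  obtain ⟨e0⟩ := h
  let e : S.presheaf.stalk s ≃+* originStalk L ⧸ Ideal.span {hypGerm L p F} :=
    e0.commRingCatIsoToRingEquiv.trans (hypStalkEquivQuot L p F)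
  refine ⟨?_, ?_, ?_⟩
  · rw [ringKrullDim_eq_of_ringEquiv e]; exact ringKrullDim_originStalk_quot L p hp F hF0
  · exact IsExcellentRing.of_ringEquiv e.symm (isExcellentRing_originStalk_quot L p F)
  · haveI := charP_originStalk_quot L p F hF0
    exact charP_of_injective_ringHom (f := e.symm.toRingHom) e.symm.injective p

/-- **ROW (X) FOR EVERY PRIME `p ≥ 3`, UNFOLDED.** For every local scheme `(S, s)` whose local ring is
`𝒪_{𝔸⁵_L,0} ⧸ (z^p + F)_0` (`ordZero F = p`) over a field of characteristic `p ≥ 3`: `S` is excellent,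
`dim S = 4 ≤ 5`, (F1) holds at `s` (`4 + 2 ≤ 2·p`), and the point centre `{s}` is permissible.  (The adapter
to res-dim4-p-3 g2's `SettingRowP p` is two lines once his Prop lands.) [OURS · row X_p of the E2 dictionary]
[folklore] -/
theorem settingRow_unfolded (p : ℕ) [hpr : Fact p.Prime] (hp3 : 3 ≤ p) (L : Type) [Field L] [CharP L p]
    (F : MvPolynomial (Fin 4) L) (hF : ordZero F = (p : ℕ∞)) (S : Scheme.{0}) [IsLocallyNoetherian S] (s : S)
    (hloc : IsLocalAt S s)
    (hpres : Nonempty (S.presheaf.stalk s ≅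
      CommRingCat.of ((P 4 L).presheaf.stalk (ξ 4 L) ⧸ stalkIdeal (hypSheaf p F) (ξ 4 L))))
    (hcl : IsClosed ({s} : Set S)) :
    Scheme.IsExcellent S ∧ topologicalKrullDim ↥S ≤ (5 : WithBot ℕ∞) ∧ CharHypothesis S s ∧
      IdealSheafData.IsPermissible (vanishingIdeal (⟨{s}, hcl⟩ : Closeds S)) := by
  obtain ⟨hdim, hexc, hchar⟩ := presented_stalk_facts hF hpres
  have hdimS : topologicalKrullDim ↥S = (4 : WithBot ℕ∞) := by
    rw [topologicalKrullDim_eq_of_isLocalAt hloc, hdim]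
  refine ⟨isExcellent_of_isLocalAt hloc hexc, ?_, ?_, ?_⟩
  · rw [hdimS]; exact_mod_cast (by norm_num : (4 : ℕ) ≤ 5)
  · -- (F1): `d = 4`, residue characteristic `p ≥ 3`
    have hc : ringChar (ResidueField (S.presheaf.stalk s)) = p := by
      haveI := hchar
      apply CharP.ringChar_of_prime_eq_zero hpr.out
      have h0 : ((p : ℕ) : S.presheaf.stalk s) = 0 := CharP.cast_eq_zero _ p
      have := congrArg (IsLocalRing.residue (S.presheaf.stalk s)) h0
      rwa [map_natCast, map_zero] at this
    exact charHypothesis_of_dim_four_of_three_le_char s hdimS (hc ▸ hp3)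
  · -- the point centre is permissible: `𝔪` is not a minimal prime of a `4`-dimensional local ring
    rw [isPermissible_vanishingIdeal_singleton_iff hcl]
    intro hmin
    have h0 : (maximalIdeal (S.presheaf.stalk s)).height = 0 := Ideal.height_eq_zero_iff.mpr hmin
    have h := IsLocalRing.maximalIdeal_height_eq_ringKrullDim (R := S.presheaf.stalk s)
    rw [h0, hdim] at h
    exact absurd h (by decide)

end Prime

end E2OfCJS

end Summit.ResolutionOfSingularities.ResolutionOfSingularities.Theorems.PIDim4

end
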